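import Summits.SmoothPoincare4.SmoothPoincare4.Theses.ConvexBisection
import Literature.Topology.FourManifolds.Corks

/-!
# drefute note (line `legendrian-r-knot-rigidity`, crux stmt-SmoothPoincare4-3546):
# the ACHIRAL CORNER of BET 1 (`stub_fillingUniqueness`)

`IsContacto` (the lines' predicate, copied verbatim) records neither orientation nor
coorientation.  A plane-field contactomorphism of 3-dimensional contact structures nevertheless
preserves the CONTACT orientations (`χ^*(α∧dα) = λ²·α∧dα`).  Consequently BET 1, instantiated at
ONE type `W` carrying two Stein structures `J₊`, `J₋` (think: of opposite chirality, i.e. both `W`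
and `W̄` Stein) and a boundary self-map `f` carrying `ξ_{J₊}` to `ξ_{J₋}`, demands a
self-diffeomorphism `Φ` of `W` whose boundary restriction carries `ξ_{J₊}` to `ξ_{J₋}` — on paper an
orientation-REVERSING `Φ`.  So BET 1 is refuted by an "achiral contact filling": no exotic pair is
needed (contrast `Disproof.ExoticContactFillingPair`, which asks for `IsEmpty (W₁ ≃ₘ W₂)` and is
therefore never instantiated at `W₁ = W₂`).  Candidate objects: Hayden–Piccirillo arXiv:2005.08928
Thm 3 (contractible `W_n ≃ −W_n` homeomorphic, NOT diffeomorphic, with an orientation-reversing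
boundary diffeo extending to a homeomorphism) — IF `W_n` and `−W_n` are both Stein with
mirror-isotopic induced structures.  Empty for Seifert seams (Alfieri–Cavallo–Matkovič: a small
Brieskorn sphere with the non-Milnor orientation has no ℚHB symplectic filling; Cavallo
arXiv:2605.15095 p. 10).

Content: `FillingUniqueness` = the statement of `stub_fillingUniqueness` verbatim;
`AchiralContactFilling` = the typed falsifier; `not_fillingUniqueness_of_achiral`. Pure logic.
-/

noncomputable section

set_option linter.dupNamespace false

open scoped Manifold ContDiff Topology
open Set Function Literature.Geometry.Symplectic Literature.Topology.FourManifolds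

namespace Summit.SmoothPoincare4.SmoothPoincare4.Cruxes.ContractibleTwistedDoubleStandard.DrefuteAchiral

section Contacto

variable {W₁ : Type*} [TopologicalSpace W₁] [ChartedSpace (EuclideanHalfSpace 4) W₁]
  [IsManifold (𝓡∂ 4) ∞ W₁] [CompactSpace W₁]
  {W₂ : Type*} [TopologicalSpace W₂] [ChartedSpace (EuclideanHalfSpace 4) W₂]
  [IsManifold (𝓡∂ 4) ∞ W₂] [CompactSpace W₂]

/-- The lines' contactomorphism predicate (same body as `LegendrianRKnotRigidity.IsContacto`). [folklore] -/
def IsContacto (J₁ : SteinStructure W₁) (J₂ : SteinStructure W₂)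
    (b₁ : BoundaryData (𝓡∂ 4) W₁ (𝓡 3)) (b₂ : BoundaryData (𝓡∂ 4) W₂ (𝓡 3))
    (ψ : b₁.carrier → b₂.carrier) : Prop :=
  ∀ (z : b₁.carrier) (v : EuclideanSpace ℝ (Fin 3)),
    mfderiv (𝓡 3) (𝓡∂ 4) (b₂.incl ∘ ψ) z v ∈ contactPlane J₂.J (b₂.incl (ψ z)) ↔
      mfderiv (𝓡 3) (𝓡∂ 4) b₁.incl z v ∈ contactPlane J₁.J (b₁.incl z)

end Contacto

/-- BET 1 of the line, `stub_fillingUniqueness`, as a `Prop` (statement copied verbatim). [folklore] -/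
def FillingUniqueness : Prop :=
  ∀ (W₁ : Type) [TopologicalSpace W₁] [T2Space W₁] [SecondCountableTopology W₁]
    [ChartedSpace (EuclideanHalfSpace 4) W₁] [IsManifold (𝓡∂ 4) ∞ W₁] [CompactSpace W₁]
    [ContractibleSpace W₁]
    (W₂ : Type) [TopologicalSpace W₂] [T2Space W₂] [SecondCountableTopology W₂]
    [ChartedSpace (EuclideanHalfSpace 4) W₂] [IsManifold (𝓡∂ 4) ∞ W₂] [CompactSpace W₂]
    [ContractibleSpace W₂]
    (J₁ : SteinStructure W₁) (J₂ : SteinStructure W₂)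
    (b₁ : BoundaryData (𝓡∂ 4) W₁ (𝓡 3)) (b₂ : BoundaryData (𝓡∂ 4) W₂ (𝓡 3))
    (ψ : b₁.carrier ≃ₘ⟮𝓡 3, 𝓡 3⟯ b₂.carrier), IsContacto J₁ J₂ b₁ b₂ ψ →
    ∃ (ψ₀ : b₁.carrier ≃ₘ⟮𝓡 3, 𝓡 3⟯ b₂.carrier) (Φ : W₁ ≃ₘ⟮𝓡∂ 4, 𝓡∂ 4⟯ W₂),
      IsContacto J₁ J₂ b₁ b₂ ψ₀ ∧ ∀ z, Φ (b₁.incl z) = b₂.incl (ψ₀ z)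

/-- **Achiral contact filling** (typed falsifier F-B of BET 1): ONE compact contractible `W` with two
Stein structures `J₊`, `J₋`, a boundary datum `b`, a self-diffeomorphism `f` of `∂W` that is a
plane-field contactomorphism `ξ_{J₊} → ξ_{J₋}`, and such that NO self-diffeomorphism of `W` restricts on
`∂W` to a plane-field contactomorphism `ξ_{J₊} → ξ_{J₋}`.  On paper (when `J₊`, `J₋` induce opposite
orientations) the last clause says: `W` has no orientation-reversing self-diffeomorphism matching the
contact structures — cf. Hayden–Piccirillo arXiv:2005.08928 Thm 3. [folklore] -/
def AchiralContactFilling : Prop :=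
  ∃ (W : Type) (_ : TopologicalSpace W) (_ : T2Space W) (_ : SecondCountableTopology W)
    (_ : ChartedSpace (EuclideanHalfSpace 4) W) (_ : IsManifold (𝓡∂ 4) ∞ W) (_ : CompactSpace W)
    (_ : ContractibleSpace W)
    (Jp Jm : SteinStructure W) (b : BoundaryData (𝓡∂ 4) W (𝓡 3))
    (f : b.carrier ≃ₘ⟮𝓡 3, 𝓡 3⟯ b.carrier),
    IsContacto Jp Jm b b f ∧
      ∀ (Φ : W ≃ₘ⟮𝓡∂ 4, 𝓡∂ 4⟯ W) (ψ₀ : b.carrier ≃ₘ⟮𝓡 3, 𝓡 3⟯ b.carrier),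
        (∀ z, Φ (b.incl z) = b.incl (ψ₀ z)) → ¬ IsContacto Jp Jm b b ψ₀

/-- **An achiral contact filling refutes BET 1** — with `W₁ = W₂ = W`, so WITHOUT any exotic pair
(the case `Disproof.ExoticContactFillingPair` cannot reach, `W ≃ₘ W` being inhabited by `refl`).
[folklore] -/
theorem not_fillingUniqueness_of_achiral (h : AchiralContactFilling) : ¬ FillingUniqueness := by
  intro hBET
  obtain ⟨W, _, _, _, _, _, _, _, Jp, Jm, b, f, hf, hno⟩ := h
  obtain ⟨ψ₀, Φ, hψ₀, hΦ⟩ := hBET W W Jp Jm b b f hf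
  exact hno Φ ψ₀ hΦ hψ₀

end Summit.SmoothPoincare4.SmoothPoincare4.Cruxes.ContractibleTwistedDoubleStandard.DrefuteAchiral

end
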